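import Literature.NumberTheory.QuadraticForms.TernaryNormClassLineFrame
import Literature.NumberTheory.QuadraticForms.HasseMinkowskiDiagonal
import Literature.NumberTheory.Automorphic.Liu2021.LemD1DataOfPlace
import HarnessLib

/-!
# A rational line frame `ᵗP T P = (a) ⊕ T_H` of a rank-`3` hermitian space `(E³, T ⊗ 1)` whose plane `T_H` is
# ISOTROPIC at a prescribed non-split place

Topic `NumberTheory/Automorphic`; namespace `Literature.NumberTheory.Automorphic.UnitaryGroup.RankThreeLineFrame`.  KERNEL
only: proved theorems, no definition, no named fact, no `sorry`.

`E/F` a quadratic extension of number fields with `c ∈ Aut(E/F)`, `c δ = -δ ≠ 0`, `δ² = d ∈ F`; `v` a finite place of `F`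
at which `E_v = E ⊗_F F_v` (the tree's `UnitaryGroup.LocalRing E v`) is a FIELD; `T ∈ Sym₃(F)` with `det T ≠ 0` (Gram matrix
of the hermitian space `(E³, T ⊗ 1)` of the unitary group `U(T ⊗ 1)`).

* §1 `not_mul_self_eq_of_isField` — `d` is not a square in `F_v` (else `(δ - κ)(δ + κ) = 0` in the field `E_v`, but
  `c ⊗ 1` fixes `F_v` and negates `δ ⊗ 1 ≠ 0`);
* §2 **`isIsotropic_standingData_two_of_norm`** — a hermitian PLANE `(E_v², H ⊗ 1)`, `H ∈ Sym₂(F)`, with `-det H` a norm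
  `W·(c ⊗ 1)W` from `E_v` is isotropic: the explicit vector `(W - H₀₁, H₀₀)` (or `(1, 0)` if `H₀₀ = 0`)
  [Jacobson1940HermitianForms, §3 (1)(a): hermitian forms over a quadratic extension are classified by their trace forms;
  a plane is isotropic iff `-det ∈ N(E_vˣ)`];
* §3 **`exists_rational_line_frame`** — there are `P ∈ GL₃(F)`, `t = (a) ∈ Sym₁(F)`, `T_H ∈ Sym₂(F)`, non-degenerate, with
  `ᵗP T P = t ⊕ᶠ T_H` (the tree's `UnitaryGroup.finSum 1 2`) and the plane `(E_v², T_H ⊗ 1)` (the tree's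
  `LemD1OfPlace.standingData E v c 2 (T_H ⊗ 1) …`) ISOTROPIC.  Proof: diagonalise `T` over `F` (`exists_congr_diagonal`,
  Serre IV §1.4), represent rationally an element of the class `-det·N(E_vˣ)·F_vˣ²` by the ternary form at a point with
  non-zero pivot (`TernaryLineFrame.exists_rational_normClass`: `u(F_v) ≤ 4`, universality of isotropic forms, density of
  `F` in `F_v` and the local square theorem), and take the explicit frame of that line (`TernaryLineFrame.exists_lineFrame`);
  the complementary plane has `-det T_H ≡ -det T · a ∈ N(E_vˣ)` up to squares, hence is isotropic by §2.

This is the «rational hyperbolic frame» input of route R for row IV-4c3 (`rankOne_theta_twist_rigidity`) of the Hodge/COR-CM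
interface (consumer: `MoeglinVignerasWaldspurger1987/RankOneThetaLiftTwistRigidityOfNonPeriodic.lean`); HC_CM is proved only
modulo the printed citations until rung 0 closes, and nothing of it is asserted here.

## References
* [Omeara1963] O. T. O'Meara, *Introduction to Quadratic Forms* (1963), §42, §63 (63:1b, 63:19).
* [Serre1973] J.-P. Serre, *A Course in Arithmetic* (1973), Ch. IV §1.4, §2.2 Thm. 6 (iv).
* [Jacobson1940HermitianForms] N. Jacobson, *A note on hermitian forms*, Bull. AMS 46 (1940), §3 (1)(a).
-/

set_option autoImplicit false

noncomputable section

open NumberField IsDedekindDomain Matrix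
open scoped Matrix MatrixGroups
open Literature.NumberTheory.QuadraticForms
open Literature.NumberTheory.Automorphic.Liu2021
open Literature.RepresentationTheory.Liu2021 (OscillatorStandingData)

namespace Literature.NumberTheory.Automorphic.UnitaryGroup.RankThreeLineFrame

variable {F : Type} (E : Type) [Field F] [NumberField F] [Field E] [NumberField E] [Algebra F E]
  (v : HeightOneSpectrum (𝓞 F)) (c : E ≃ₐ[F] E) [Algebra.IsQuadraticExtension F E]
  {δ : E} (hcδ : c δ = -δ) (hδ : δ ≠ 0) {d : F} (hd : δ * δ = algebraMap F E d)


/-! ## §1 `d` is not a square in `F_v` at a non-split place -/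

omit [Algebra.IsQuadraticExtension F E] in
include hcδ hδ hd in
/-- **`d ∉ F_v²` when `E ⊗_F F_v` is a field**: if `κ² = d` then `(δ ⊗ 1 - ι_v κ)(δ ⊗ 1 + ι_v κ) = 0`, so `δ ⊗ 1 = ± ι_v κ`
is fixed by `c ⊗ 1`, whereas `(c ⊗ 1)(δ ⊗ 1) = -δ ⊗ 1 ≠ 0`. [cite: CasselsFrohlichANT1967, Ch. II §10] -/
theorem not_mul_self_eq_of_isField (hE : IsField (LocalRing E v)) (κ : v.adicCompletion F) :
    κ * κ ≠ (algebraMap F (v.adicCompletion F)) d := by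
  intro hκ
  letI : Field (LocalRing E v) := hE.toField
  have hδ'c : conjLocal E c v (algebraMap E (LocalRing E v) δ) = -algebraMap E (LocalRing E v) δ := by
    rw [conjLocal_algebraMap, hcδ, map_neg]
  have hδ'sq : algebraMap E (LocalRing E v) δ * algebraMap E (LocalRing E v) δ =
      toLocalRing E v ((algebraMap F (v.adicCompletion F)) d) := by
    rw [← map_mul, hd]
    exact (toLocalRing_coe E v d).symm
  have hprod : (algebraMap E (LocalRing E v) δ - toLocalRing E v κ) *
      (algebraMap E (LocalRing E v) δ + toLocalRing E v κ) = 0 := by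
    have h2 : toLocalRing E v κ * toLocalRing E v κ = toLocalRing E v ((algebraMap F (v.adicCompletion F)) d) := by
      rw [← map_mul, hκ]
    linear_combination hδ'sq - h2
  have hfix : conjLocal E c v (algebraMap E (LocalRing E v) δ) = algebraMap E (LocalRing E v) δ := by
    rcases mul_eq_zero.1 hprod with h | h
    · rw [sub_eq_zero.1 h, conjLocal_toLocalRing]
    · rw [eq_neg_of_add_eq_zero_left h, map_neg, conjLocal_toLocalRing]
  rw [hfix] at hδ'c
  have hδ0 : algebraMap E (LocalRing E v) δ ≠ 0 := ((IsUnit.mk0 δ hδ).map (algebraMap E (LocalRing E v))).ne_zero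
  haveI : CharZero (v.adicCompletion F) := charZero_of_injective_algebraMap (algebraMap F _).injective
  have h20 : toLocalRing E v (2 : (v.adicCompletion F)) ≠ 0 := (map_ne_zero _).2 two_ne_zero
  refine mul_ne_zero h20 hδ0 ?_
  rw [map_ofNat]
  linear_combination hδ'c

/-! ## §2 A hermitian plane with `-det` a norm is isotropic -/

/-- **A hermitian plane `(E_v², H ⊗ 1)`, `H ∈ Sym₂(F)`, whose `-det H` is a norm `(c ⊗ 1)W · W` from `E_v`, is ISOTROPIC**:
for `H₀₀ = 0` the first basis vector is isotropic, otherwise `u = (W - H₀₁, H₀₀)` has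
`h(u, u) = H₀₀ · ((c ⊗ 1)W · W + det H) = 0` and `u ≠ 0`. [cite: Jacobson1940HermitianForms, §3 (1)(a)] -/
theorem isIsotropic_standingData_two_of_norm (H : Matrix (Fin 2) (Fin 2) F) (hH : H.IsSymm)
    (hJh : ((H.map (algebraMap F E)).map c)ᵀ = H.map (algebraMap F E)) (hJdet : (H.map (algebraMap F E)).det ≠ 0)
    (W : LocalRing E v) (hW : conjLocal E c v W * W = -(((algebraMap E (LocalRing E v)).comp (algebraMap F E)) H.det)) :
    LemD1.IsIsotropic (LemD1OfPlace.standingData E v c 2 (H.map (algebraMap F E)) hcδ hδ (le_refl 2) hJh hJdet) := by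
  have hmc : ∀ a : F, conjLocal E c v (((algebraMap E (LocalRing E v)).comp (algebraMap F E)) a) =
      ((algebraMap E (LocalRing E v)).comp (algebraMap F E)) a := fun a => by
    simp only [RingHom.comp_apply, conjLocal_algebraMap, AlgEquiv.commutes]
  have hq : H 1 0 = H 0 1 := hH.apply 0 1
  have hdet : H.det = H 0 0 * H 1 1 - H 0 1 * H 0 1 := by rw [Matrix.det_fin_two, hq]
  -- the form in coordinates
  have hform : ∀ u : Fin 2 → LocalRing E v,
      (LemD1OfPlace.standingData E v c 2 (H.map (algebraMap F E)) hcδ hδ (le_refl 2) hJh hJdet).form u u =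
        conjLocal E c v (u 0) * (((algebraMap E (LocalRing E v)).comp (algebraMap F E)) (H 0 0) * u 0 +
            ((algebraMap E (LocalRing E v)).comp (algebraMap F E)) (H 0 1) * u 1) +
          conjLocal E c v (u 1) * (((algebraMap E (LocalRing E v)).comp (algebraMap F E)) (H 0 1) * u 0 +
            ((algebraMap E (LocalRing E v)).comp (algebraMap F E)) (H 1 1) * u 1) := by
    intro u
    have hgram : (LemD1OfPlace.standingData E v c 2 (H.map (algebraMap F E)) hcδ hδ (le_refl 2) hJh hJdet).gram =
        (H.map (algebraMap F E)).map (algebraMap E (LocalRing E v)) := by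
      rw [LemD1OfPlace.standingData_gram]
      exact LemD1OfPlace.localGram_eq E v 2 _
    simp only [OscillatorStandingData.form, AlgebraicGeometry.ShimuraVarieties.hermForm, dotProduct, Matrix.mulVec,
      Function.comp_apply, OscillatorStandingData.σ_apply, LemD1OfPlace.standingData_conj_apply, hgram, Matrix.map_apply,
      Fin.sum_univ_two, hq, RingHom.comp_apply]
  by_cases hp : H 0 0 = 0
  · refine ⟨![1, 0], fun h => one_ne_zero ((by simpa using congrFun h 0) : (1 : LocalRing E v) = 0), ?_⟩
    rw [hform]
    simp only [Matrix.cons_val_zero, Matrix.cons_val_one, hp, map_zero, map_one, mul_zero, zero_mul, add_zero, mul_one]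
  · refine ⟨![W - ((algebraMap E (LocalRing E v)).comp (algebraMap F E)) (H 0 1), ((algebraMap E (LocalRing E v)).comp (algebraMap F E)) (H 0 0)],
      fun h => hp ?_, ?_⟩
    · have h1 := congrFun h 1
      simp only [Matrix.cons_val_one, Matrix.cons_val, Pi.zero_apply] at h1
      exact (algebraMap F E).injective ((algebraMap E (LocalRing E v)).injective
        (by rw [← RingHom.comp_apply, h1, map_zero, map_zero]))
    · rw [hform]
      simp only [Matrix.cons_val_zero, Matrix.cons_val_one, map_sub, hmc]
      rw [hdet, map_sub, map_mul, map_mul] at hW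
      linear_combination (((algebraMap E (LocalRing E v)).comp (algebraMap F E)) (H 0 0)) * hW

/-! ## §3 The rational line frame with isotropic complement -/

include hd in
/-- **RATIONAL LINE FRAME WITH ISOTROPIC COMPLEMENT AT A NON-SPLIT PLACE.**  For `T ∈ Sym₃(F)`, `det T ≠ 0`, and a finite
place `v` with `E ⊗_F F_v` a field, there are `P ∈ GL₃(F)`, `t ∈ Sym₁(F)`, `T_H ∈ Sym₂(F)` non-degenerate with
`ᵗP T P = t ⊕ᶠ T_H` and the hermitian plane `(E_v², T_H ⊗ 1)` ISOTROPIC.  (Diagonalise `T` over `F`; the ternary form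
represents rationally, at a point with non-zero pivot, an element `a` of the `v`-adic class `-det·N(E_vˣ)·F_vˣ²` —
`u(F_v) ≤ 4`, universality of isotropic forms, density and the local square theorem —; frame the line of that point;
the complement has `-det T_H ≡ -det·a ∈ N(E_vˣ)` modulo squares, hence is isotropic.)
[cite: Omeara1963, §63C Prop. 63:19 p. 170] [cite: Serre1973, Ch. IV §1.4] [cite: Jacobson1940HermitianForms, §3 (1)(a)] -/
theorem exists_rational_line_frame (T : Matrix (Fin 3) (Fin 3) F) (hT : T.IsSymm) (hTd : IsUnit T.det)
    (hE : IsField (LocalRing E v)) :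
    ∃ (P : GL (Fin 3) F) (t : Matrix (Fin 1) (Fin 1) F) (T_H : Matrix (Fin 2) (Fin 2) F) (_ : t.IsSymm) (_ : T_H.IsSymm)
      (_ : IsUnit t.det) (_ : IsUnit T_H.det)
      (hJHh : ((T_H.map (algebraMap F E)).map c)ᵀ = T_H.map (algebraMap F E))
      (hJHdet : (T_H.map (algebraMap F E)).det ≠ 0),
      (P : Matrix (Fin 3) (Fin 3) F)ᵀ * T * (P : Matrix (Fin 3) (Fin 3) F) = UnitaryGroup.finSum 1 2 t T_H ∧
        LemD1.IsIsotropic (LemD1OfPlace.standingData E v c 2 (T_H.map (algebraMap F E)) hcδ hδ (le_refl 2) hJHh hJHdet) := by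
  haveI : NeZero (2 : F) := ⟨two_ne_zero⟩
  haveI : CharZero (v.adicCompletion F) := charZero_of_injective_algebraMap (algebraMap F _).injective
  -- (1) diagonalise `T` over `F`
  obtain ⟨P₀, Q₀, a, hPQ, hQP, hdiag, ha⟩ := exists_congr_diagonal T hT
  have ha : ∀ i, a i ≠ 0 := ha hTd.ne_zero
  -- (2) a rational point with non-zero pivot representing the class `-(a₀a₁a₂)·N·□`
  obtain ⟨σ, x, w, s, r, hx0, hw, hsr, hval⟩ :=
    TernaryLineFrame.exists_rational_normClass F v ha (not_mul_self_eq_of_isField E v c hcδ hδ hd hE)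
  set a' : Fin 3 → F := fun i => a (σ i) with ha'
  have hn : s ^ 2 - (algebraMap F (v.adicCompletion F)) d * r ^ 2 ≠ 0 := by
    intro h
    rcases eq_or_ne r 0 with hr | hr
    · rw [hr] at hsr h
      have hs : s = 0 := pow_eq_zero_iff two_ne_zero |>.1 (by linear_combination h)
      exact (hsr.resolve_right fun h' => h' rfl) hs
    · exact not_mul_self_eq_of_isField E v c hcδ hδ hd hE (s / r) (by field_simp; linear_combination h)
  have hΔ : a 0 * a 1 * a 2 ≠ 0 := mul_ne_zero (mul_ne_zero (ha 0) (ha 1)) (ha 2)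
  have hΔ' : a' 0 * a' 1 * a' 2 = a 0 * a 1 * a 2 := by
    have h1 : ∏ i, a' i = ∏ i, a i := Equiv.prod_comp σ a
    simpa only [Fin.prod_univ_three] using h1
  -- (3) the explicit frame of the line, the value `aval = Σ a'ᵢ xᵢ²` and its image in `F_v`
  obtain ⟨P₁, H, hP₁, hP₁det, hHdet, hHs⟩ := TernaryLineFrame.exists_lineFrame a' x
  set aval : F := ∑ i, a' i * x i ^ 2 with haval
  have hιaval : (algebraMap F (v.adicCompletion F)) aval =
      -((algebraMap F (v.adicCompletion F)) (a 0 * a 1 * a 2)) *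
        (s ^ 2 - (algebraMap F (v.adicCompletion F)) d * r ^ 2) * w ^ 2 := by
    rw [← hval, haval, map_sum]
    simp only [map_mul, map_pow, ha']
  have haval0 : aval ≠ 0 := by
    intro h
    rw [h, map_zero] at hιaval
    exact mul_ne_zero (mul_ne_zero (neg_ne_zero.2 ((map_ne_zero _).2 hΔ)) hn) (pow_ne_zero 2 hw) hιaval.symm
  have hP₁0 : P₁.det ≠ 0 := by
    rw [hP₁det]
    exact mul_ne_zero (mul_ne_zero (ha (σ 0)) hx0) haval0
  have hHdet' : H.det = a' 0 ^ 2 * x 0 ^ 2 * (a 0 * a 1 * a 2) * aval := by rw [hHdet, hΔ']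
  have hHdet0 : H.det ≠ 0 := by
    rw [hHdet']
    exact mul_ne_zero (mul_ne_zero (mul_ne_zero (pow_ne_zero 2 (ha (σ 0))) (pow_ne_zero 2 hx0)) hΔ) haval0
  -- (4) the composite frame
  set Pm : Matrix (Fin 3) (Fin 3) F := P₀.submatrix id σ * P₁ with hPm
  have hP₀det : P₀.det ≠ 0 := by
    intro h
    have := congrArg Matrix.det hPQ
    rw [Matrix.det_mul, h, zero_mul, Matrix.det_one] at this
    exact zero_ne_one this
  have hPmdet : Pm.det ≠ 0 := by
    rw [hPm, Matrix.det_mul, Matrix.det_permute', mul_assoc]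
    refine mul_ne_zero ?_ (mul_ne_zero hP₀det hP₁0)
    rcases Int.units_eq_one_or (Equiv.Perm.sign σ) with h | h <;> rw [h] <;> simp
  have hcongr : Pmᵀ * T * Pm = UnitaryGroup.finSum 1 2 !![aval] H := by
    have h1 : Pmᵀ * T * Pm = P₁ᵀ * ((P₀.submatrix id σ)ᵀ * T * P₀.submatrix id σ) * P₁ := by
      simp only [hPm, Matrix.transpose_mul, Matrix.mul_assoc]
    rw [h1, TernaryLineFrame.congr_submatrix, hdiag, Matrix.submatrix_diagonal_equiv]
    exact hP₁
  -- hermitian-ness and non-degeneracy of `T_H ⊗ 1`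
  have hJHh : ((H.map (algebraMap F E)).map c)ᵀ = H.map (algebraMap F E) := by
    have h1 : (H.map (algebraMap F E)).map c = H.map (algebraMap F E) := by
      rw [Matrix.map_map]
      exact Matrix.ext fun i j => AlgEquiv.commutes c (H i j)
    rw [h1]
    exact hHs.map _
  have hJHdet : (H.map (algebraMap F E)).det ≠ 0 := by
    rw [← RingHom.mapMatrix_apply, ← RingHom.map_det]
    exact (map_ne_zero _).2 hHdet0
  -- (5) `-det H` is a norm from `E_v`
  have hιdet : (algebraMap F (v.adicCompletion F)) H.det =
      -(((algebraMap F (v.adicCompletion F)) (a' 0) * (algebraMap F (v.adicCompletion F)) (x 0) *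
        ((algebraMap F (v.adicCompletion F)) (a 0) * (algebraMap F (v.adicCompletion F)) (a 1) *
          (algebraMap F (v.adicCompletion F)) (a 2)) * w) ^ 2 * (s ^ 2 - (algebraMap F (v.adicCompletion F)) d * r ^ 2)) := by
    rw [hHdet', map_mul, hιaval]
    simp only [map_mul, map_pow]
    ring
  set μ : (v.adicCompletion F) := (algebraMap F (v.adicCompletion F)) (a' 0) * (algebraMap F (v.adicCompletion F)) (x 0) *
    ((algebraMap F (v.adicCompletion F)) (a 0) * (algebraMap F (v.adicCompletion F)) (a 1) *
      (algebraMap F (v.adicCompletion F)) (a 2)) * w with hμ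
  clear_value μ
  have hδ'c : conjLocal E c v (algebraMap E (LocalRing E v) δ) = -algebraMap E (LocalRing E v) δ := by
    rw [conjLocal_algebraMap, hcδ, map_neg]
  have hδ'sq : algebraMap E (LocalRing E v) δ * algebraMap E (LocalRing E v) δ =
      toLocalRing E v ((algebraMap F (v.adicCompletion F)) d) := by
    rw [← map_mul, hd]
    exact (toLocalRing_coe E v d).symm
  have hW : conjLocal E c v
        (toLocalRing E v μ * (toLocalRing E v s + toLocalRing E v r * algebraMap E (LocalRing E v) δ)) *
      (toLocalRing E v μ * (toLocalRing E v s + toLocalRing E v r * algebraMap E (LocalRing E v) δ)) =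
        -(((algebraMap E (LocalRing E v)).comp (algebraMap F E)) H.det) := by
    have hdetv : ((algebraMap E (LocalRing E v)).comp (algebraMap F E)) H.det =
        toLocalRing E v ((algebraMap F (v.adicCompletion F)) H.det) := (toLocalRing_coe E v H.det).symm
    rw [hdetv, hιdet, map_neg, neg_neg]
    simp only [map_mul, map_add, map_sub, map_pow, conjLocal_toLocalRing, hδ'c]
    linear_combination (-(toLocalRing E v μ) ^ 2 * (toLocalRing E v r) ^ 2) * hδ'sq
  refine ⟨Matrix.GeneralLinearGroup.mkOfDetNeZero Pm hPmdet, !![aval], H, ?_, hHs, ?_, hHdet0.isUnit, hJHh, hJHdet,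
    hcongr, isIsotropic_standingData_two_of_norm E v c hcδ hδ H hHs hJHh hJHdet _ hW⟩
  · exact Matrix.IsSymm.ext fun i j => by fin_cases i; fin_cases j; rfl
  · rw [Matrix.det_fin_one]
    exact (isUnit_iff_ne_zero.2 haval0)

end Literature.NumberTheory.Automorphic.UnitaryGroup.RankThreeLineFrame

end
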